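import Mathlib.Combinatorics.SetFamily.Compression.Down
import Mathlib.Tactic
import HarnessLib
import HarnessLib.Audit.Tags
import Summits.CriticalPhenomena.PercolationContinuityZ3.Theorems.PercNearOneGluingNoHeavyLowerTailSahiRainbowTwoColourDeficitMixL

/-!
# The sparse residual is LOCAL, III: an S₁-point excludes every S₂-point (the K-case and assembly)

Support file (seat `prim-masterthm-p1`, gen 42; `--supports stmt-CriticalPhenomena-4575`).  No `sorry`, standard axioms.
Blueprint `run/shared/lean/prim/prim-masterthm/FROM-prim-masterthm-p1-g42-*.md` (PROOFS §1–§2).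

SETTING (`…SahiRainbowTwoColourDeficitDefs`): `Z = X ⊔ Y ⊆ 2^G` complement-closed, `L = monoMeets X Y`; an S₁-point `y₁`
(`S1At X Y G y₁ P Q`: upper members `P ∈ X`, `Q ∈ Y` with `P ∩ Q = {y₁}`, `P ∪ Q = G`, lower members `P ∖ y₁`, `Q ∖ y₁ ∈ Z`,
`{y₁} ∉ L`, no non-empty twin at `y₁`) and an S₂-point `y₂` (a D-point `DAt` or a Q-point `Q3At`: `{y₂} ∈ L`, no non-empty
twin at `y₂`, monochromatic bisections among the upper members).

THIS FILE (S₁ versus S₂, second half): the **K-case** (`P ∖ y₁ ∈ Y`, `Q ∖ y₁ ∈ X`) and the assembly.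
* `S1At.K_partA`: at `y₂ ∈ P`, a monochromatic `X`-bisection member through `y₁` is `P` itself and `P ∖ y₂ ∈ X`;
* `S1At.K_partD`: then no monochromatic `Y`-bisection at `y₂` (steps 4–7 of the blueprint: the colours `G ∖ P`, `P ∖ y₂`,
  `Q ∩ B`, `P ∖ B` and the twins they form at `y₁` / `y₂`);
* **`S1At.false_of_DAt`, `S1At.false_of_Q3At`, `S1At.false_of_Q3At'`: an S₁-point and an S₂-point (D-point, or Q-point of
  either orientation) cannot coexist in one configuration** (three points of `G` and `Disjoint X Y` assumed).
HONEST FRAMING: unconditional combinatorial lemmas (the local three-direction analysis of the sparse residual). [this work]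
-/

namespace Summit.CriticalPhenomena.PercolationContinuityZ3.Theorems.SahiColouredDaykin

open Finset
open scoped FinsetFamily

variable {α : Type*} [DecidableEq α]

/-! ### M4. The K-case (both lower members of the S₁-point have the other colour) -/

section MixK

variable {X Y : Finset (Finset α)} {G : Finset α} {y₁ y₂ : α} {P Q : Finset α}

/-- K-case, Part A: an `X`-bisection member `A ∋ y₁` at `y₂ ∈ P` must be `P` itself, and then `P ∖ y₂ ∈ X`. [this work] -/
theorem S1At.K_partA (hXY : Disjoint X Y) (h₁ : S1At X Y G y₁ P Q) (hKP : Q.erase y₁ ∈ X) (hKQ : P.erase y₁ ∈ Y)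
    (hne : y₁ ≠ y₂) (hy₂P : y₂ ∈ P) {A A' : Finset α} (hA : Bisect X (X ∪ Y) G y₂ A A') (hy₁A : y₁ ∈ A)
    (htw₂ : NoTwin (monoMeets X Y) y₂) : A = P ∧ P.erase y₂ ∈ X := by
  have hy₂Q : y₂ ∉ Q := h₁.notMem_Q hy₂P hne.symm
  -- Step 1: `A ∖ y₂ ∈ X`
  have hA2 : A.erase y₂ ∈ X := by
    rcases mem_union.1 hA.erase_mem with h | hAY
    · exact h
    exfalso
    have ne1 : Q ≠ A.erase y₂ := by
      intro e
      have hA'eq : A' = P.erase y₁ := by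
        rw [hA.eq_insert_sdiff, h₁.erase_P_eq]
        ext t; simp only [mem_insert, mem_sdiff]
        constructor
        · rintro (rfl | ⟨htG, htA⟩)
          · exact ⟨h₁.P_subset hy₂P, hy₂Q⟩
          · refine ⟨htG, fun htQ => htA ?_⟩
            rw [e] at htQ; exact mem_of_mem_erase htQ
        · rintro ⟨htG, htQ⟩
          by_cases ht2 : t = y₂
          · exact Or.inl ht2
          · right; refine ⟨htG, fun htA => htQ ?_⟩
            rw [e]; exact mem_erase.2 ⟨ht2, htA⟩
      exact disjoint_left.1 hXY hA.mem' (hA'eq ▸ hKQ)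
    have neA : A ≠ Q.erase y₁ := fun e => (notMem_erase y₁ Q) (e ▸ hy₁A)
    have c_mem : A ∩ Q.erase y₁ ∈ monoMeets X Y := inter_mem_monoMeets_left hA.mem hKP neA
    have c'_mem : Q ∩ A.erase y₂ ∈ monoMeets X Y := inter_mem_monoMeets_right h₁.memQ hAY ne1
    have e1 : Q ∩ A.erase y₂ = insert y₁ (A ∩ Q.erase y₁) := by
      ext t; simp only [mem_inter, mem_erase, mem_insert]
      constructor
      · rintro ⟨htQ, -, htA⟩
        by_cases h : t = y₁
        · exact Or.inl h
        · exact Or.inr ⟨htA, h, htQ⟩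
      · rintro (rfl | ⟨htA, -, htQ⟩)
        · exact ⟨h₁.y_mem_Q, hne, hy₁A⟩
        · exact ⟨htQ, fun ht2 => hy₂Q (ht2 ▸ htQ), htA⟩
    rw [e1] at c'_mem
    have hc := h₁.noTwin c_mem c'_mem (fun h => (notMem_erase y₁ Q) (mem_inter.1 h).2)
    rw [hc, insert_empty] at c'_mem
    exact h₁.singleton_notMem c'_mem
  -- Step 2: `A = P`
  have hAP : A = P := by
    by_contra hAP
    have ne1 : P ≠ A.erase y₂ := fun e => (notMem_erase y₂ A) (e ▸ hy₂P)
    have c_mem : P ∩ A.erase y₂ ∈ monoMeets X Y := inter_mem_monoMeets_left h₁.memP hA2 ne1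
    have c'_mem : P ∩ A ∈ monoMeets X Y := inter_mem_monoMeets_left h₁.memP hA.mem (Ne.symm hAP)
    have e1 : P ∩ A = insert y₂ (P ∩ A.erase y₂) := by rw [← inter_insert_of_mem hy₂P, insert_erase hA.y_mem]
    rw [e1] at c'_mem
    have hc := htw₂ c_mem c'_mem (fun h => (notMem_erase y₂ A) (mem_inter.1 h).2)
    have : y₁ ∈ P ∩ A.erase y₂ := mem_inter.2 ⟨h₁.y_mem_P, mem_erase.2 ⟨hne, hy₁A⟩⟩
    rw [hc] at this; exact notMem_empty _ this
  subst hAP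
  exact ⟨rfl, hA2⟩

/-- K-case: with `insert y₂ (G ∖ P) ∈ X`, the lower member `Q ∖ y₁ = G ∖ P` is a colour. [this work] -/
theorem S1At.K_sP_mem (h₁ : S1At X Y G y₁ P Q) (hKP : Q.erase y₁ ∈ X) (hy₂P : y₂ ∈ P)
    (hR : insert y₂ (G \ P) ∈ X) : Q.erase y₁ ∈ monoMeets X Y := by
  have hy₂ : y₂ ∉ G \ P := fun h => (mem_sdiff.1 h).2 hy₂P
  have ne : Q.erase y₁ ≠ insert y₂ (G \ P) := by
    rw [h₁.erase_Q_eq]; intro e; exact hy₂ (e.symm ▸ mem_insert_self _ _)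
  have := inter_mem_monoMeets_left (Y := Y) hKP hR ne
  rw [h₁.erase_Q_eq] at this ⊢
  rwa [inter_insert_of_notMem hy₂, inter_self] at this

/-- K-case: `P ∖ y₂ ∈ X` makes `P ∖ y₂` a colour. [this work] -/
theorem S1At.K_Pe_mem (h₁ : S1At X Y G y₁ P Q) (hy₂P : y₂ ∈ P) (hP2 : P.erase y₂ ∈ X) :
    P.erase y₂ ∈ monoMeets X Y := by
  have ne : P ≠ P.erase y₂ := fun e => (notMem_erase y₂ P) (e ▸ hy₂P)
  have := inter_mem_monoMeets_left (Y := Y) h₁.memP hP2 ne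
  rwa [inter_eq_right.2 (erase_subset y₂ P)] at this

/-- K-case: if `Q ∖ y₁` is a colour then `Q` is not a colour. [this work] -/
theorem S1At.K_Q_notMem (h₁ : S1At X Y G y₁ P Q) (hsP : Q.erase y₁ ∈ monoMeets X Y) (hQ : Q ∈ monoMeets X Y) :
    False := by
  have hQ' := hQ
  rw [← insert_erase h₁.y_mem_Q] at hQ'
  have hc := h₁.noTwin hsP hQ' (notMem_erase y₁ Q)
  rw [hc, insert_empty] at hQ'
  exact h₁.singleton_notMem hQ'

/-- K-case, Part D: no `Y`-bisection `{B, B'}` with `y₁ ∈ B` at `y₂`. [this work] -/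
theorem S1At.K_partD (h₁ : S1At X Y G y₁ P Q) (hKQ : P.erase y₁ ∈ Y) (hne : y₁ ≠ y₂) (hy₂P : y₂ ∈ P)
    (hR : insert y₂ (G \ P) ∈ X) (hP2 : P.erase y₂ ∈ X) (hsP : Q.erase y₁ ∈ monoMeets X Y)
    {B B' : Finset α} (hB : Bisect Y (X ∪ Y) G y₂ B B') (hy₁B : y₁ ∈ B) (htw₂ : NoTwin (monoMeets X Y) y₂) :
    False := by
  have hy₂Q : y₂ ∉ Q := h₁.notMem_Q hy₂P hne.symm
  have hy₂B : y₂ ∈ B := hB.y_mem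
  have hQB : Q ≠ B := fun e => hy₂Q (e ▸ hy₂B)
  have hy₂GP : y₂ ∉ G \ P := fun h => (mem_sdiff.1 h).2 hy₂P
  have hy₁GP : y₁ ∉ G \ P := fun h => (mem_sdiff.1 h).2 h₁.y_mem_P
  have QB_mem : Q ∩ B ∈ monoMeets X Y := inter_mem_monoMeets_right h₁.memQ hB.mem hQB
  -- Step 4: `B ∖ y₂ ∈ Y`
  have hB2 : B.erase y₂ ∈ Y := by
    rcases mem_union.1 hB.erase_mem with hBX | h
    swap
    · exact h
    exfalso
    have ne1 : insert y₂ (G \ P) ≠ B.erase y₂ := fun e => (notMem_erase y₂ B) (e ▸ mem_insert_self _ _)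
    have c_mem : insert y₂ (G \ P) ∩ B.erase y₂ ∈ monoMeets X Y := inter_mem_monoMeets_left hR hBX ne1
    have e1 : insert y₂ (G \ P) ∩ B.erase y₂ = (G \ P) ∩ B := by
      rw [insert_inter_of_notMem (notMem_erase y₂ B), inter_erase, erase_eq_of_notMem]
      exact fun h => hy₂GP (mem_inter.1 h).1
    have e2 : Q ∩ B = insert y₁ ((G \ P) ∩ B) := by rw [h₁.Q_eq, insert_inter_of_mem hy₁B]
    rw [e1] at c_mem
    rw [e2] at QB_mem
    have hc := h₁.noTwin c_mem QB_mem (fun h => hy₁GP (mem_inter.1 h).1)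
    rw [hc, insert_empty] at QB_mem
    exact h₁.singleton_notMem QB_mem
  -- Step 5: `B = insert y₂ Q` or `P ⊆ B`
  have hGB : G \ B ∈ X ∪ Y := by
    have := hB.erase_mem'
    rwa [hB.eq_insert_sdiff, erase_insert (fun h => (mem_sdiff.1 h).2 hy₂B)] at this
  have step5 : B = insert y₂ Q ∨ P ⊆ B := by
    by_contra h5
    push Not at h5
    obtain ⟨h5a, h5b⟩ := h5
    obtain ⟨t, htP, htB⟩ := not_subset.1 h5b
    have hy₂PQ : y₂ ∈ P.erase y₁ := mem_erase.2 ⟨hne.symm, hy₂P⟩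
    have neB' : B' ≠ P.erase y₁ := by
      intro e
      apply h5a
      rw [hB.swap.eq_insert_sdiff, e, h₁.erase_P_eq, Finset.sdiff_sdiff_eq_self h₁.Q_subset]
    have c'_mem : B' ∩ P.erase y₁ ∈ monoMeets X Y := inter_mem_monoMeets_right hB.mem' hKQ neB'
    have e1 : B' ∩ P.erase y₁ = insert y₂ (P ∩ (G \ B)) := by
      rw [hB.eq_insert_sdiff, insert_inter_of_mem hy₂PQ, inter_erase, erase_eq_of_notMem, inter_comm]
      exact fun h => (mem_sdiff.1 (mem_inter.1 h).1).2 hy₁B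
    rw [e1] at c'_mem
    have c_mem : P ∩ (G \ B) ∈ monoMeets X Y := by
      rcases mem_union.1 hGB with hX | hY
      · exact inter_mem_monoMeets_left h₁.memP hX (fun e => (mem_sdiff.1 (e ▸ h₁.y_mem_P)).2 hy₁B)
      · have ne : G \ B ≠ P.erase y₁ := fun e => (mem_sdiff.1 (e.symm ▸ hy₂PQ)).2 hy₂B
        have := inter_mem_monoMeets_right (X := X) hY hKQ ne
        rwa [inter_erase, erase_eq_of_notMem (fun h => (mem_sdiff.1 (mem_inter.1 h).1).2 hy₁B), inter_comm] at this
    have hc := htw₂ c_mem c'_mem (fun h => (mem_sdiff.1 (mem_inter.1 h).2).2 hy₂B)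
    have : t ∈ P ∩ (G \ B) := mem_inter.2 ⟨htP, mem_sdiff.2 ⟨h₁.P_subset htP, htB⟩⟩
    rw [hc] at this; exact notMem_empty _ this
  rcases step5 with hBQ | hPB
  · -- Step 7: `B = insert y₂ Q` makes `Q` a colour
    have : Q ∩ B = Q := inter_eq_left.2 (hBQ ▸ subset_insert _ _)
    rw [this] at QB_mem
    exact h₁.K_Q_notMem hsP QB_mem
  · -- Step 6: `P ⊆ B`: twin `P ∖ {y₁, y₂}` at `y₁`
    have ne1 : B.erase y₂ ≠ P.erase y₁ := by
      intro e; have : y₁ ∈ B.erase y₂ := mem_erase.2 ⟨hne, hy₁B⟩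
      rw [e] at this; exact (notMem_erase y₁ P) this
    have c_mem : B.erase y₂ ∩ P.erase y₁ ∈ monoMeets X Y := inter_mem_monoMeets_right hB2 hKQ ne1
    have e1 : insert y₁ (B.erase y₂ ∩ P.erase y₁) = P.erase y₂ := by
      ext t; simp only [mem_insert, mem_inter, mem_erase]
      constructor
      · rintro (rfl | ⟨⟨ht2, -⟩, -, htP⟩)
        · exact ⟨hne, h₁.y_mem_P⟩
        · exact ⟨ht2, htP⟩
      · rintro ⟨ht2, htP⟩
        by_cases h : t = y₁
        · exact Or.inl h
        · exact Or.inr ⟨⟨ht2, hPB htP⟩, h, htP⟩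
    have c'_mem : insert y₁ (B.erase y₂ ∩ P.erase y₁) ∈ monoMeets X Y := by rw [e1]; exact h₁.K_Pe_mem hy₂P hP2
    have hc := h₁.noTwin c_mem c'_mem (fun h => (notMem_erase y₁ P) (mem_inter.1 h).2)
    rw [hc, insert_empty] at c'_mem
    exact h₁.singleton_notMem c'_mem

end MixK


/-! ### M5. Assembly: an S₁-point excludes every S₂-point -/

section MixAll

variable {X Y : Finset (Finset α)} {G : Finset α} {y₁ y₂ : α} {P Q : Finset α}

/-- If `Q = {y₁}` then no `Y`-bisection at `y₂ ≠ y₁`. [this work] -/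
theorem S1At.false_of_Q_single_bisectY (h₁ : S1At X Y G y₁ P Q) (hQ : Q = {y₁}) (hne : y₁ ≠ y₂)
    {W W' : Finset α} (hW : Bisect Y (X ∪ Y) G y₂ W W') : False := by
  have key : ∀ {W W' : Finset α}, Bisect Y (X ∪ Y) G y₂ W W' → y₁ ∈ W → False := by
    intro W W' hW hy₁W
    have ne : Q ≠ W := by
      intro e; have := hW.y_mem; rw [← e, hQ, mem_singleton] at this; exact hne this.symm
    have := inter_mem_monoMeets_right (X := X) h₁.memQ hW.mem ne
    rw [hQ, singleton_inter_of_mem hy₁W] at this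
    exact h₁.singleton_notMem this
  by_cases hy₁W : y₁ ∈ W
  · exact key hW hy₁W
  · have : y₁ ∈ W' := by rw [hW.mem'_iff]; exact Or.inr ⟨h₁.P_subset h₁.y_mem_P, hy₁W⟩
    exact key hW.swap this

/-- Core, D-point at `y₂ ∈ P`. [this work] -/
theorem S1At.false_of_DAt_mem (hXY : Disjoint X Y) (h₁ : S1At X Y G y₁ P Q) {A A' B B' : Finset α}
    (h₂ : DAt X Y G y₂ A A' B B') (hne : y₁ ≠ y₂) (hG3 : ∃ t ∈ G, t ≠ y₁ ∧ t ≠ y₂) (hy₂P : y₂ ∈ P) : False := by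
  have hyG : y₁ ∈ G := h₁.P_subset h₁.y_mem_P
  rcases mem_union.1 h₁.erase_P with hLx | hKQ
  · exact h₁.false_of_Lx_bisectX hLx hne hG3 h₂.bisX
  rcases mem_union.1 h₁.erase_Q with hKP | hLy
  swap
  · exact h₁.false_of_Ly_bisectY hLy hne hy₂P h₂.bisY
  -- K-case: Part A on the `X`-bisection member through `y₁`
  have partA : ∀ {A A' : Finset α}, Bisect X (X ∪ Y) G y₂ A A' → y₁ ∈ A →
      insert y₂ (G \ P) ∈ X ∧ P.erase y₂ ∈ X := by
    intro A A' hA hy₁A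
    obtain ⟨rfl, hP2⟩ := h₁.K_partA hXY hKP hKQ hne hy₂P hA hy₁A h₂.noTwin
    exact ⟨hA.eq_insert_sdiff ▸ hA.mem', hP2⟩
  obtain ⟨hR, hP2⟩ : insert y₂ (G \ P) ∈ X ∧ P.erase y₂ ∈ X := by
    by_cases hy₁A : y₁ ∈ A
    · exact partA h₂.bisX hy₁A
    · have : y₁ ∈ A' := by rw [h₂.bisX.mem'_iff]; exact Or.inr ⟨hyG, hy₁A⟩
      exact partA h₂.bisX.swap this
  have hsP := h₁.K_sP_mem hKP hy₂P hR
  by_cases hy₁B : y₁ ∈ B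
  · exact h₁.K_partD hKQ hne hy₂P hR hP2 hsP h₂.bisY hy₁B h₂.noTwin
  · have : y₁ ∈ B' := by rw [h₂.bisY.mem'_iff]; exact Or.inr ⟨hyG, hy₁B⟩
    exact h₁.K_partD hKQ hne hy₂P hR hP2 hsP h₂.bisY.swap this h₂.noTwin

/-- Core, Q-point of the same orientation (`{y₂} ∈ X`, `G ∈ Y`) at `y₂ ∈ P`. [this work] -/
theorem S1At.false_of_Q3At_mem (hXY : Disjoint X Y) (h₁ : S1At X Y G y₁ P Q) {C C' : Finset α}
    (h₂ : Q3At X Y G y₂ C C') (hne : y₁ ≠ y₂) (hG3 : ∃ t ∈ G, t ≠ y₁ ∧ t ≠ y₂) (hy₂P : y₂ ∈ P) : False := by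
  have hyG : y₁ ∈ G := h₁.P_subset h₁.y_mem_P
  have hy₂Q : y₂ ∉ Q := h₁.notMem_Q hy₂P hne.symm
  rcases mem_union.1 h₁.erase_P with hLx | hKQ
  · exact h₁.false_of_Lx_bisectX hLx hne hG3 h₂.bis
  rcases mem_union.1 h₁.erase_Q with hKP | hLy
  swap
  · exact h₁.false_of_Ly_memY hLy hne hy₂P h₂.univ_mem hyG (h₁.P_subset hy₂P)
  -- K-case: Part A, then `Q = Q ∩ G` is a colour
  have partA : ∀ {A A' : Finset α}, Bisect X (X ∪ Y) G y₂ A A' → y₁ ∈ A → insert y₂ (G \ P) ∈ X := by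
    intro A A' hA hy₁A
    obtain ⟨rfl, -⟩ := h₁.K_partA hXY hKP hKQ hne hy₂P hA hy₁A h₂.noTwin
    exact hA.eq_insert_sdiff ▸ hA.mem'
  have hR : insert y₂ (G \ P) ∈ X := by
    by_cases hy₁C : y₁ ∈ C
    · exact partA h₂.bis hy₁C
    · have : y₁ ∈ C' := by rw [h₂.bis.mem'_iff]; exact Or.inr ⟨hyG, hy₁C⟩
      exact partA h₂.bis.swap this
  have hsP := h₁.K_sP_mem hKP hy₂P hR
  have hQG : Q ≠ G := fun e => hy₂Q (e ▸ h₁.P_subset hy₂P)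
  have := inter_mem_monoMeets_right (X := X) h₁.memQ h₂.univ_mem hQG
  rw [inter_eq_left.2 h₁.Q_subset] at this
  exact h₁.K_Q_notMem hsP this

/-- Core, Q-point of the opposite orientation (`{y₂} ∈ Y`, `G ∈ X`) at `y₂ ∈ P`. [this work] -/
theorem S1At.false_of_Q3At'_mem (h₁ : S1At X Y G y₁ P Q) {C C' : Finset α} (h₂ : Q3At Y X G y₂ C C')
    (hne : y₁ ≠ y₂) (hy₂P : y₂ ∈ P) : False := by
  have hyG : y₁ ∈ G := h₁.P_subset h₁.y_mem_P
  have hy₂G : y₂ ∈ G := h₁.P_subset hy₂P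
  have hy₂Q : y₂ ∉ Q := h₁.notMem_Q hy₂P hne.symm
  have bisY : Bisect Y (X ∪ Y) G y₂ C C' := h₂.bis.of_eq (union_comm Y X)
  have htw₂ : NoTwin (monoMeets X Y) y₂ := by rw [monoMeets_comm]; exact h₂.noTwin
  rcases mem_union.1 h₁.erase_P with hLx | hKQ
  · exact h₁.false_of_Lx_Q3opp hLx hne h₂
  rcases mem_union.1 h₁.erase_Q with hKP | hLy
  swap
  · exact h₁.false_of_Ly_bisectY hLy hne hy₂P bisY
  -- K-case
  by_cases hPG : P = G
  · have hQ : Q = {y₁} := by rw [h₁.Q_eq, hPG, sdiff_self]; rfl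
    exact h₁.false_of_Q_single_bisectY hQ hne bisY
  have P_mem : P ∈ monoMeets X Y := by
    have := inter_mem_monoMeets_left (Y := Y) h₁.memP h₂.univ_mem hPG
    rwa [inter_eq_left.2 h₁.P_subset] at this
  have hGe : G.erase y₂ ∈ X ∪ Y := by rw [union_comm]; exact h₂.erase_univ_mem
  rcases mem_union.1 hGe with hGX | hGY
  · -- twin `P ∖ y₂` at `y₂`
    have ne : P ≠ G.erase y₂ := fun e => (notMem_erase y₂ G) (e ▸ hy₂P)
    have c_mem := inter_mem_monoMeets_left (Y := Y) h₁.memP hGX ne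
    rw [inter_erase, inter_eq_left.2 h₁.P_subset] at c_mem
    have P_mem' := P_mem
    rw [← insert_erase hy₂P] at P_mem'
    have hc := htw₂ c_mem P_mem' (notMem_erase y₂ P)
    have : y₁ ∈ P.erase y₂ := mem_erase.2 ⟨hne, h₁.y_mem_P⟩
    rw [hc] at this; exact notMem_empty _ this
  · -- `G ∖ P` is a colour; then `Q` must not be one
    have hsP : Q.erase y₁ ∈ monoMeets X Y := by
      have ne : Q.erase y₁ ≠ G := fun e => (notMem_erase y₁ Q) (e.symm ▸ hyG)
      have := inter_mem_monoMeets_left (Y := Y) hKP h₂.univ_mem ne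
      rwa [inter_eq_left.2 ((erase_subset y₁ Q).trans h₁.Q_subset)] at this
    by_cases hQG : Q = G.erase y₂
    · -- then `P = {y₁, y₂}` is a colour and `{y₂}` is a twin at `y₁`
      have hP : P = insert y₁ {y₂} := by
        rw [h₁.P_eq, hQG, sdiff_erase hy₂G, Finset.sdiff_self, insert_empty]
      have hs₂ : ({y₂} : Finset α) ∈ monoMeets X Y := by rw [monoMeets_comm]; exact h₂.singleton_mem
      rw [hP] at P_mem
      have hc := h₁.noTwin hs₂ P_mem (by rw [mem_singleton]; exact hne)
      exact singleton_ne_empty y₂ hc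
    · have ne : Q ≠ G.erase y₂ := hQG
      have := inter_mem_monoMeets_right (X := X) h₁.memQ hGY ne
      rw [inter_erase, inter_eq_left.2 h₁.Q_subset, erase_eq_of_notMem hy₂Q] at this
      exact h₁.K_Q_notMem hsP this

/-- **An S₁-point and a D-point cannot coexist** (three points in `G` needed). [this work] -/
theorem S1At.false_of_DAt (hXY : Disjoint X Y) (h₁ : S1At X Y G y₁ P Q) {A A' B B' : Finset α}
    (h₂ : DAt X Y G y₂ A A' B B') (hne : y₁ ≠ y₂) (hG3 : ∃ t ∈ G, t ≠ y₁ ∧ t ≠ y₂) : False := by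
  by_cases hy₂P : y₂ ∈ P
  · exact h₁.false_of_DAt_mem hXY h₂ hne hG3 hy₂P
  · have hy₂Q : y₂ ∈ Q := h₁.mem_Q_of_notMem_P h₂.bisX.y_mem_G hy₂P
    exact h₁.swap.false_of_DAt_mem hXY.symm h₂.swap hne hG3 hy₂Q

/-- **An S₁-point and a Q-point (same orientation) cannot coexist.** [this work] -/
theorem S1At.false_of_Q3At (hXY : Disjoint X Y) (h₁ : S1At X Y G y₁ P Q) {C C' : Finset α}
    (h₂ : Q3At X Y G y₂ C C') (hne : y₁ ≠ y₂) (hG3 : ∃ t ∈ G, t ≠ y₁ ∧ t ≠ y₂) : False := by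
  by_cases hy₂P : y₂ ∈ P
  · exact h₁.false_of_Q3At_mem hXY h₂ hne hG3 hy₂P
  · have hy₂Q : y₂ ∈ Q := h₁.mem_Q_of_notMem_P h₂.bis.y_mem_G hy₂P
    exact h₁.swap.false_of_Q3At'_mem h₂ hne hy₂Q

/-- **An S₁-point and a Q-point (opposite orientation) cannot coexist.** [this work] -/
theorem S1At.false_of_Q3At' (hXY : Disjoint X Y) (h₁ : S1At X Y G y₁ P Q) {C C' : Finset α}
    (h₂ : Q3At Y X G y₂ C C') (hne : y₁ ≠ y₂) (hG3 : ∃ t ∈ G, t ≠ y₁ ∧ t ≠ y₂) : False := by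
  by_cases hy₂P : y₂ ∈ P
  · exact h₁.false_of_Q3At'_mem h₂ hne hy₂P
  · have hy₂Q : y₂ ∈ Q := h₁.mem_Q_of_notMem_P h₂.bis.y_mem_G hy₂P
    exact h₁.swap.false_of_Q3At_mem hXY.symm h₂ hne hG3 hy₂Q

end MixAll

end Summit.CriticalPhenomena.PercolationContinuityZ3.Theorems.SahiColouredDaykin
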